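import Literature.Computability.AlgebraicComplexity.TensorRestrictionRank
import Literature.Barriers.MatrixMultiplication.RectangularBarrier
import HarnessLib

/-!
# Partitioned tensors, sub-tensors over sets of parts, and direct sums of families

Topic `Literature/Computability/AlgebraicComplexity`.  The block calculus of §7 ("Fixing Holes") of
Vassilevska Williams–Xu–Xu–Zhou, *New bounds for matrix multiplication: from alpha to omega*
(SODA 2024, arXiv:2307.07970), in the tree's coordinates (a tensor is `T : X → Y → Z → K`;
restriction is `TensorRestrictsTo`, `AsymptoticSpectrum.lean`):

* a **partitioned tensor** is a tensor together with part maps `pX : X → 𝒫_X`, `pY : Y → 𝒫_Y`,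
  `pZ : Z → 𝒫_Z` (VXXZ §7, first paragraph: `X = ⊔_{i ∈ [M_X]} X_i`, …; equal part sizes are not
  needed for the calculus and are not imposed);
* `partSubtensor pX pY pZ T A B C` is VXXZ's `T‖_{P_X, P_Y, P_Z}` — "the subtensor of `T` over the
  sets of parts `P_X, P_Y, P_Z`", i.e. the zero-out of all variables outside those parts; a *broken
  copy of `T` with holes `H_X, H_Y, H_Z`* is `T‖_{𝒫_X ∖ H_X, 𝒫_Y ∖ H_Y, 𝒫_Z ∖ H_Z}`
  (= `partSubtensor … Hᶜ Hᶜ Hᶜ`);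
* `familyDirectSum T` is the direct sum `⊕_{j ∈ J} T_j` of a finite family of tensors of one format,
  realised block-diagonally on `(J × X) × (J × Y) × (J × Z)`; for a constant family it is the
  tree's `⟨|J|⟩ ⊗ T` (`familyDirectSum_const`).

All statements are PROVED restriction facts ("`≥`" = `TensorRestrictsTo`), the ingredients of the
proof of VXXZ Thm. 7.2: zero-outs are restrictions (`tensorRestrictsTo_partSubtensor`,
`partSubtensor_partSubtensor`); direct sums are functorial (`familyDirectSum_mono`), drop summands
along injections of the index set (`familyDirectSum_reindex`), re-associate
(`familyDirectSum_prod`) and project to a summand (`familyDirectSum_apply_le`); a symmetry of a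
partitioned tensor RELABELS a sub-tensor over parts into the sub-tensor over the permuted parts
(`partSubtensor_relabel`, VXXZ: "we relabel the variables in `T_hole` according to the permutations
`π_X, π_Y, π_Z`, obtaining another broken copy of `T` with sets of holes `π_X(P_X^{(0)}), …`"); and
the direct sum of the `8` sub-tensors over the cells of a `2 × 2 × 2` subdivision of
`P_X × P_Y × P_Z` restricts to `T‖_{P_X,P_Y,P_Z}` (`familyDirectSum_cells_le`, the GLUING step
"write `T‖_{P_X,P_Y,P_Z}` as a sum of 8 subtensors").

## References

* V. Vassilevska Williams, Y. Xu, Z. Xu, R. Zhou, *New bounds for matrix multiplication: from alpha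
  to omega*, SODA 2024, arXiv:2307.07970, §3.3 (zero-outs, subtensors), §7 (partitioned tensors,
  broken copies, `T‖_{P_X,P_Y,P_Z}`, proof of Thm. 7.2). [VassilevskaWilliamsXuXuZhou2024]
* P. Bürgisser, M. Clausen, M. A. Shokrollahi, *Algebraic Complexity Theory* (1997), (14.51)/(15.25)
  (restriction preorder, direct sums). [BurgisserClausenShokrollahi1997]
-/

open scoped BigOperators
open Finset

namespace Literature.Computability.AlgebraicComplexity

universe u

variable {K : Type u} [CommSemiring K]

/-! ## Sub-tensors over sets of parts -/

section PartSubtensor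

variable {X Y Z PX PY PZ : Type*} [DecidableEq PX] [DecidableEq PY] [DecidableEq PZ]
variable (pX : X → PX) (pY : Y → PY) (pZ : Z → PZ)

/-- **`T‖_{A, B, C}`, the sub-tensor of a partitioned tensor over sets of parts** (VXXZ 2024, §7):
the zero-out of `T` keeping exactly the variables whose parts lie in `A ⊆ 𝒫_X`, `B ⊆ 𝒫_Y`,
`C ⊆ 𝒫_Z`.  A broken copy of `T` with holes `H_X, H_Y, H_Z` is `T‖_{H_Xᶜ, H_Yᶜ, H_Zᶜ}`.
[cite: VassilevskaWilliamsXuXuZhou2024, §7 (notation T‖)] -/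
def partSubtensor (T : X → Y → Z → K) (A : Finset PX) (B : Finset PY) (C : Finset PZ) :
    X → Y → Z → K :=
  fun x y z => if pX x ∈ A ∧ pY y ∈ B ∧ pZ z ∈ C then T x y z else 0

/-- Entries of `T‖_{A,B,C}`. [folklore] -/
theorem partSubtensor_apply (T : X → Y → Z → K) (A : Finset PX) (B : Finset PY) (C : Finset PZ)
    (x : X) (y : Y) (z : Z) :
    partSubtensor pX pY pZ T A B C x y z = if pX x ∈ A ∧ pY y ∈ B ∧ pZ z ∈ C then T x y z else 0 :=
  rfl

/-- Iterated zero-outs intersect: `(T‖_{A,B,C})‖_{A',B',C'} = T‖_{A∩A', B∩B', C∩C'}`. [folklore] -/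
theorem partSubtensor_partSubtensor (T : X → Y → Z → K) (A A' : Finset PX) (B B' : Finset PY) (C C' : Finset PZ) :
    partSubtensor pX pY pZ (partSubtensor pX pY pZ T A B C) A' B' C' =
      partSubtensor pX pY pZ T (A ∩ A') (B ∩ B') (C ∩ C') := by
  funext x y z
  simp only [partSubtensor, mem_inter]
  by_cases hA : pX x ∈ A <;> by_cases hA' : pX x ∈ A' <;> by_cases hB : pY y ∈ B <;>
    by_cases hB' : pY y ∈ B' <;> by_cases hC : pZ z ∈ C <;> by_cases hC' : pZ z ∈ C' <;>
    simp [hA, hA', hB, hB', hC, hC']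

/-- `T‖_{∅, B, C} = 0`. [folklore] -/
theorem partSubtensor_empty_left (T : X → Y → Z → K) (B : Finset PY) (C : Finset PZ) :
    partSubtensor pX pY pZ T ∅ B C = 0 := by
  funext x y z
  simp [partSubtensor]

/-- `T‖_{A, ∅, C} = 0`. [folklore] -/
theorem partSubtensor_empty_mid (T : X → Y → Z → K) (A : Finset PX) (C : Finset PZ) :
    partSubtensor pX pY pZ T A ∅ C = 0 := by
  funext x y z
  simp [partSubtensor]

/-- `T‖_{A, B, ∅} = 0`. [folklore] -/
theorem partSubtensor_empty_right (T : X → Y → Z → K) (A : Finset PX) (B : Finset PY) :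
    partSubtensor pX pY pZ T A B ∅ = 0 := by
  funext x y z
  simp [partSubtensor]

/-- Over all parts nothing is zeroed out: `T‖_{𝒫_X, 𝒫_Y, 𝒫_Z} = T`. [folklore] -/
theorem partSubtensor_univ [Fintype PX] [Fintype PY] [Fintype PZ] (T : X → Y → Z → K) :
    partSubtensor pX pY pZ T univ univ univ = T := by
  funext x y z
  simp [partSubtensor]

variable [Fintype X] [Fintype Y] [Fintype Z]

/-- **Zero-outs are restrictions**: `T ≥ T‖_{A,B,C}` (diagonal `0/1` matrices; VXXZ §3.3: a
zero-out is a restriction). [cite: VassilevskaWilliamsXuXuZhou2024, §3.3] -/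
theorem tensorRestrictsTo_partSubtensor [DecidableEq X] [DecidableEq Y] [DecidableEq Z]
    (T : X → Y → Z → K) (A : Finset PX) (B : Finset PY) (C : Finset PZ) :
    TensorRestrictsTo T (partSubtensor pX pY pZ T A B C) := by
  classical
  refine ⟨fun x' x => if x = x' ∧ pX x ∈ A then 1 else 0,
    fun y' y => if y = y' ∧ pY y ∈ B then 1 else 0,
    fun z' z => if z = z' ∧ pZ z ∈ C then 1 else 0, fun x' y' z' => ?_⟩
  rw [Finset.sum_eq_single x' (fun x _ hx => by simp [hx]) (by simp),
    Finset.sum_eq_single y' (fun y _ hy => by simp [hy]) (by simp),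
    Finset.sum_eq_single z' (fun z _ hz => by simp [hz]) (by simp)]
  simp only [partSubtensor, true_and]
  by_cases hA : pX x' ∈ A <;> by_cases hB : pY y' ∈ B <;> by_cases hC : pZ z' ∈ C <;>
    simp [hA, hB, hC]

/-- Monotonicity of zero-outs: `T‖_{A,B,C} ≥ T‖_{A',B',C'}` for `A' ⊆ A`, `B' ⊆ B`, `C' ⊆ C`.
[folklore] -/
theorem partSubtensor_mono [DecidableEq X] [DecidableEq Y] [DecidableEq Z] (T : X → Y → Z → K) {A A' : Finset PX} {B B' : Finset PY}
    {C C' : Finset PZ} (hA : A' ⊆ A) (hB : B' ⊆ B) (hC : C' ⊆ C) :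
    TensorRestrictsTo (partSubtensor pX pY pZ T A B C) (partSubtensor pX pY pZ T A' B' C') := by
  have h := tensorRestrictsTo_partSubtensor pX pY pZ (partSubtensor pX pY pZ T A B C) A' B' C'
  rwa [partSubtensor_partSubtensor, inter_eq_right.2 hA, inter_eq_right.2 hB,
    inter_eq_right.2 hC] at h

/-- **Relabelling by a symmetry** (VXXZ 2024, proof of Thm. 7.2): if `(σ_X, σ_Y, σ_Z)` permutes the
variables, maps parts to parts (inducing `π_X, π_Y, π_Z` on `𝒫_X, 𝒫_Y, 𝒫_Z`) and preserves `T`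
(Property 7.1, first two items), then `T‖_{A,B,C} ≥ T‖_{π_X(A), π_Y(B), π_Z(C)}` — indeed the two
are isomorphic, the latter being the former read in the relabelled variables.
[cite: VassilevskaWilliamsXuXuZhou2024, §7 (Property 7.1; proof of Thm. 7.2, relabelling step)] -/
theorem partSubtensor_relabel (T : X → Y → Z → K) (σX : Equiv.Perm X) (σY : Equiv.Perm Y) (σZ : Equiv.Perm Z)
    (πX : Equiv.Perm PX) (πY : Equiv.Perm PY) (πZ : Equiv.Perm PZ)
    (hpX : ∀ x, pX (σX x) = πX (pX x)) (hpY : ∀ y, pY (σY y) = πY (pY y))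
    (hpZ : ∀ z, pZ (σZ z) = πZ (pZ z)) (hT : ∀ x y z, T (σX x) (σY y) (σZ z) = T x y z)
    (A : Finset PX) (B : Finset PY) (C : Finset PZ) :
    TensorRestrictsTo (partSubtensor pX pY pZ T A B C)
      (partSubtensor pX pY pZ T (A.image πX) (B.image πY) (C.image πZ)) := by
  have key : partSubtensor pX pY pZ T (A.image πX) (B.image πY) (C.image πZ) = fun x y z =>
      partSubtensor pX pY pZ T A B C (σX.symm x) (σY.symm y) (σZ.symm z) := by
    funext x y z
    have hx : pX (σX.symm x) = πX.symm (pX x) := by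
      rw [Equiv.eq_symm_apply, ← hpX, Equiv.apply_symm_apply]
    have hy : pY (σY.symm y) = πY.symm (pY y) := by
      rw [Equiv.eq_symm_apply, ← hpY, Equiv.apply_symm_apply]
    have hz : pZ (σZ.symm z) = πZ.symm (pZ z) := by
      rw [Equiv.eq_symm_apply, ← hpZ, Equiv.apply_symm_apply]
    have hT' : T (σX.symm x) (σY.symm y) (σZ.symm z) = T x y z := by
      conv_rhs => rw [← σX.apply_symm_apply x, ← σY.apply_symm_apply y, ← σZ.apply_symm_apply z]
      exact (hT _ _ _).symm
    have himX : pX x ∈ A.image πX ↔ πX.symm (pX x) ∈ A := by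
      constructor
      · rintro h
        obtain ⟨a, ha, hax⟩ := mem_image.1 h
        rwa [← hax, Equiv.symm_apply_apply]
      · intro h
        exact mem_image.2 ⟨_, h, Equiv.apply_symm_apply _ _⟩
    have himY : pY y ∈ B.image πY ↔ πY.symm (pY y) ∈ B := by
      constructor
      · rintro h
        obtain ⟨a, ha, hax⟩ := mem_image.1 h
        rwa [← hax, Equiv.symm_apply_apply]
      · intro h
        exact mem_image.2 ⟨_, h, Equiv.apply_symm_apply _ _⟩
    have himZ : pZ z ∈ C.image πZ ↔ πZ.symm (pZ z) ∈ C := by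
      constructor
      · rintro h
        obtain ⟨a, ha, hax⟩ := mem_image.1 h
        rwa [← hax, Equiv.symm_apply_apply]
      · intro h
        exact mem_image.2 ⟨_, h, Equiv.apply_symm_apply _ _⟩
    simp only [partSubtensor, hx, hy, hz, hT', himX, himY, himZ]
  rw [key]
  exact TensorRestrictsTo.comap _ _ _ _

/-- For a permutation, the image of a complement is the complement of the image (so relabelling a
broken copy with holes `H` gives the broken copy with holes `π(H)`). [folklore] -/
theorem image_compl_perm {α : Type*} [Fintype α] [DecidableEq α] (π : Equiv.Perm α) (s : Finset α) :
    (sᶜ).image π = (s.image π)ᶜ := by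
  ext a
  simp only [mem_image, mem_compl]
  constructor
  · rintro ⟨b, hb, rfl⟩ ⟨c, hc, hcb⟩
    exact hb (π.injective hcb ▸ hc)
  · intro h
    refine ⟨π.symm a, fun hs => h ⟨_, hs, π.apply_symm_apply a⟩, π.apply_symm_apply a⟩

end PartSubtensor

/-! ## Direct sums of families of tensors of one format -/

section FamilyDirectSum

variable {J J' L X Y Z X' Y' Z' : Type*}

/-- **The direct sum `⊕_{j ∈ J} T_j` of a family of tensors of one format**, block-diagonally on
`(J × X) × (J × Y) × (J × Z)`: the block `(j, j, j)` carries `T_j`, mixed blocks vanish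
(independent copies of tensors on disjoint sets of variables; VXXZ §3.1/§7: "the direct sum
`⊕_{i=1}^r T_i`"). [cite: VassilevskaWilliamsXuXuZhou2024, §7 (Thm. 7.2, the direct sum of broken copies)] -/
def familyDirectSum [DecidableEq J] (T : J → X → Y → Z → K) : J × X → J × Y → J × Z → K :=
  fun a b c => if a.1 = b.1 ∧ b.1 = c.1 then T a.1 a.2 b.2 c.2 else 0

/-- Entries of a family direct sum. [folklore] -/
theorem familyDirectSum_apply [DecidableEq J] (T : J → X → Y → Z → K) (a : J × X) (b : J × Y)
    (c : J × Z) :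
    familyDirectSum T a b c = if a.1 = b.1 ∧ b.1 = c.1 then T a.1 a.2 b.2 c.2 else 0 := rfl

/-- The diagonal blocks. [folklore] -/
@[simp] theorem familyDirectSum_diag [DecidableEq J] (T : J → X → Y → Z → K) (j : J) (x : X) (y : Y)
    (z : Z) : familyDirectSum T (j, x) (j, y) (j, z) = T j x y z := by
  simp [familyDirectSum]

/-- A constant family: `⊕_{j ∈ Fin r} S = ⟨r⟩ ⊗ S`, the tree's "`r` independent copies of `S`".
[folklore] -/
theorem familyDirectSum_const (r : ℕ) (S : X → Y → Z → K) :
    familyDirectSum (fun _ : Fin r => S) = kroneckerTensor (unitTensor K r) S := by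
  funext a b c
  simp only [familyDirectSum, kroneckerTensor, unitTensor_apply]
  split_ifs <;> simp

variable [Fintype J] [Fintype L] [Fintype X] [Fintype Y] [Fintype Z]

/-- **Direct sums are functorial for restriction**: if `T_j ≥ S_j` for every `j` then
`⊕_j T_j ≥ ⊕_j S_j` (block-diagonal linear maps). [cite: BurgisserClausenShokrollahi1997, Prop. 15.25] -/
theorem familyDirectSum_mono [DecidableEq J] {T : J → X → Y → Z → K} {S : J → X' → Y' → Z' → K}
    (h : ∀ j, TensorRestrictsTo (T j) (S j)) :
    TensorRestrictsTo (familyDirectSum T) (familyDirectSum S) := by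
  classical
  choose A B C hS using h
  refine ⟨fun a' a => if a.1 = a'.1 then A a.1 a'.2 a.2 else 0,
    fun b' b => if b.1 = b'.1 then B b.1 b'.2 b.2 else 0,
    fun c' c => if c.1 = c'.1 then C c.1 c'.2 c.2 else 0, fun a' b' c' => ?_⟩
  -- split the three sums over `J × _` and kill the off-diagonal block indices
  simp only [Fintype.sum_prod_type]
  rw [Finset.sum_eq_single a'.1 (fun j _ hj => by simp [hj]) (by simp)]
  rw [Finset.sum_congr rfl fun x _ => Finset.sum_eq_single b'.1 (fun j _ hj => by simp [hj]) (by simp)]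
  rw [Finset.sum_congr rfl fun x _ => Finset.sum_congr rfl fun y _ =>
    Finset.sum_eq_single c'.1 (fun j _ hj => by simp [hj]) (by simp)]
  simp only [if_true, familyDirectSum_apply]
  by_cases hab : a'.1 = b'.1
  · by_cases hbc : b'.1 = c'.1
    · simp only [hab, hbc, and_self, if_true, hS]
    · simp [hab, hbc]
  · simp [hab]

/-- **Dropping summands**: along an injection `e : J' ↪ J` of index sets, `⊕_{j ∈ J} T_j ≥ ⊕_{j' ∈ J'} T_{e j'}`
(a coordinate sub-tensor). [folklore] -/
theorem familyDirectSum_reindex [DecidableEq J] [DecidableEq J'] (T : J → X → Y → Z → K)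
    {e : J' → J} (he : Function.Injective e) :
    TensorRestrictsTo (familyDirectSum T) (familyDirectSum fun j' => T (e j')) := by
  have key : (familyDirectSum fun j' => T (e j')) = fun a b c =>
      familyDirectSum T (e a.1, a.2) (e b.1, b.2) (e c.1, c.2) := by
    funext a b c
    simp only [familyDirectSum_apply, he.eq_iff]
  rw [key]
  exact TensorRestrictsTo.comap (familyDirectSum T) (fun a : J' × X => ((e a.1, a.2) : J × X))
    (fun b : J' × Y => ((e b.1, b.2) : J × Y)) (fun c : J' × Z => ((e c.1, c.2) : J × Z))

/-- **Projection to a summand**: `⊕_j T_j ≥ T_{j₀}`. [folklore] -/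
theorem familyDirectSum_apply_le [DecidableEq J] (T : J → X → Y → Z → K) (j₀ : J) :
    TensorRestrictsTo (familyDirectSum T) (T j₀) := by
  have key : T j₀ = fun x y z => familyDirectSum T (j₀, x) (j₀, y) (j₀, z) := by
    funext x y z
    simp
  rw [key]
  exact TensorRestrictsTo.comap (familyDirectSum T) (fun x : X => ((j₀, x) : J × X))
    (fun y : Y => ((j₀, y) : J × Y)) (fun z : Z => ((j₀, z) : J × Z))

/-- **Re-association**: a direct sum over `J × L` restricts to (indeed is isomorphic to) the
iterated direct sum `⊕_j (⊕_l T_{j,l})`. [folklore] -/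
theorem familyDirectSum_prod [DecidableEq J] [DecidableEq L] (T : J → L → X → Y → Z → K) :
    TensorRestrictsTo (familyDirectSum fun p : J × L => T p.1 p.2)
      (familyDirectSum fun j => familyDirectSum (T j)) := by
  have key : (familyDirectSum fun j => familyDirectSum (T j)) = fun a b c =>
      familyDirectSum (fun p : J × L => T p.1 p.2) ((a.1, a.2.1), a.2.2) ((b.1, b.2.1), b.2.2)
        ((c.1, c.2.1), c.2.2) := by
    funext a b c
    simp only [familyDirectSum_apply, Prod.mk.injEq]
    split_ifs <;> simp_all
  rw [key]
  exact TensorRestrictsTo.comap (familyDirectSum fun p : J × L => T p.1 p.2)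
    (fun a : J × (L × X) => (((a.1, a.2.1), a.2.2) : (J × L) × X))
    (fun b : J × (L × Y) => (((b.1, b.2.1), b.2.2) : (J × L) × Y))
    (fun c : J × (L × Z) => (((c.1, c.2.1), c.2.2) : (J × L) × Z))

end FamilyDirectSum

/-! ## Block maps out of a direct sum -/

section BlockMaps

variable {J X Y Z X'' Y'' Z'' : Type*} [Fintype J] [Fintype X] [Fintype Y] [Fintype Z]

/-- **Linear maps out of a direct sum act blockwise**: for block rows of matrices
`(𝔄_j)_j, (𝔅_j)_j, (ℭ_j)_j`, `⊕_j S_j ≥ Σ_j (𝔄_j ⊗ 𝔅_j ⊗ ℭ_j) · S_j` — the image of a direct sum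
is the SUM of the images of the summands (the sum map). [folklore] -/
theorem familyDirectSum_le_sum_blocks [DecidableEq J] (S : J → X → Y → Z → K)
    (𝔄 : J → X'' → X → K) (𝔅 : J → Y'' → Y → K) (ℭ : J → Z'' → Z → K) :
    TensorRestrictsTo (familyDirectSum S)
      (fun x'' y'' z'' => ∑ j, ∑ x, ∑ y, ∑ z, 𝔄 j x'' x * 𝔅 j y'' y * ℭ j z'' z * S j x y z) := by
  refine ⟨fun x'' a => 𝔄 a.1 x'' a.2, fun y'' b => 𝔅 b.1 y'' b.2, fun z'' c => ℭ c.1 z'' c.2,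
    fun x'' y'' z'' => ?_⟩
  simp only [Fintype.sum_prod_type, familyDirectSum_apply]
  refine Finset.sum_congr rfl fun j _ => Finset.sum_congr rfl fun x _ => ?_
  rw [Finset.sum_eq_single j (fun j₂ _ hj => by simp [hj.symm]) (by simp)]
  refine Finset.sum_congr rfl fun y _ => ?_
  rw [Finset.sum_eq_single j (fun j₃ _ hj => by simp [hj.symm]) (by simp)]
  simp

end BlockMaps

/-! ## Gluing the cells of a `2 × 2 × 2` subdivision -/

section Glue

variable {X Y Z PX PY PZ : Type*} [Fintype X] [Fintype Y] [Fintype Z]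
  [DecidableEq PX] [DecidableEq PY] [DecidableEq PZ]
variable (pX : X → PX) (pY : Y → PY) (pZ : Z → PZ)

/-- Membership in one of two disjoint cells is membership in their union, counted in `K`:
`[p ∈ A₁] + [p ∈ A₀] = [p ∈ A₀ ∪ A₁]`. [folklore] -/
private theorem boole_true_add_boole_false {α : Type*} [DecidableEq α] (A : Bool → Finset α)
    (h : Disjoint (A false) (A true)) (p : α) :
    ((if p ∈ A true then 1 else 0) + (if p ∈ A false then 1 else 0) : K) =
      if p ∈ A false ∪ A true then 1 else 0 := by
  by_cases h0 : p ∈ A false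
  · have h1 : p ∉ A true := Finset.disjoint_left.1 h h0
    simp [h0, h1]
  · by_cases h1 : p ∈ A true <;> simp [h0, h1]

/-- Factoring a triple sum of products of one-variable factors. [folklore] -/
private theorem sum_sum_sum_mul_factor {α β γ : Type*} [Fintype α] [Fintype β] [Fintype γ]
    (f : α → K) (g : β → K) (h : γ → K) (c : K) :
    ∑ a, ∑ b, ∑ c', f a * (g b * (h c' * c)) = (∑ a, f a) * ((∑ b, g b) * ((∑ c', h c') * c)) := by
  rw [Finset.sum_mul]
  refine Finset.sum_congr rfl fun a _ => ?_
  rw [Finset.sum_mul, Finset.mul_sum]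
  refine Finset.sum_congr rfl fun b _ => ?_
  rw [Finset.sum_mul, Finset.mul_sum, Finset.mul_sum]

/-- **Gluing** (VXXZ 2024, proof of Thm. 7.2: "we write `T‖_{P_X,P_Y,P_Z}` as a sum of 8
subtensors"): if `P_X = A₀ ⊔ A₁`, `P_Y = B₀ ⊔ B₁`, `P_Z = C₀ ⊔ C₁` (disjoint unions of sets of
parts), then the direct sum of the eight cell sub-tensors `T‖_{A_a, B_b, C_c}`, `a, b, c ∈ {0,1}`,
restricts to `T‖_{P_X, P_Y, P_Z}` (the sum map identifying the eight disjoint copies of the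
variables with the original ones is a restriction). [cite: VassilevskaWilliamsXuXuZhou2024, §7 (proof of Thm. 7.2, decomposition into 8 subtensors)] -/
theorem familyDirectSum_cells_le [DecidableEq X] [DecidableEq Y] [DecidableEq Z] (T : X → Y → Z → K)
    (A : Bool → Finset PX) (B : Bool → Finset PY) (C : Bool → Finset PZ)
    (hA : Disjoint (A false) (A true)) (hB : Disjoint (B false) (B true))
    (hC : Disjoint (C false) (C true)) :
    TensorRestrictsTo
      (familyDirectSum fun j : Bool × Bool × Bool =>
        partSubtensor pX pY pZ T (A j.1) (B j.2.1) (C j.2.2))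
      (partSubtensor pX pY pZ T (A false ∪ A true) (B false ∪ B true) (C false ∪ C true)) := by
  classical
  -- block rows of diagonal 0/1 matrices selecting the cells
  have h := familyDirectSum_le_sum_blocks
    (fun j : Bool × Bool × Bool => partSubtensor pX pY pZ T (A j.1) (B j.2.1) (C j.2.2))
    (fun j x'' x => if x = x'' ∧ pX x ∈ A j.1 then (1 : K) else 0)
    (fun j y'' y => if y = y'' ∧ pY y ∈ B j.2.1 then (1 : K) else 0)
    (fun j z'' z => if z = z'' ∧ pZ z ∈ C j.2.2 then (1 : K) else 0)
  convert h using 1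
  funext x'' y'' z''
  -- evaluate the inner sums: only `(x, y, z) = (x'', y'', z'')` contributes
  have inner : ∀ j : Bool × Bool × Bool,
      (∑ x, ∑ y, ∑ z, (if x = x'' ∧ pX x ∈ A j.1 then (1 : K) else 0) *
        (if y = y'' ∧ pY y ∈ B j.2.1 then (1 : K) else 0) *
        (if z = z'' ∧ pZ z ∈ C j.2.2 then (1 : K) else 0) *
        partSubtensor pX pY pZ T (A j.1) (B j.2.1) (C j.2.2) x y z) =
      (if pX x'' ∈ A j.1 then 1 else 0) * ((if pY y'' ∈ B j.2.1 then 1 else 0) *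
        ((if pZ z'' ∈ C j.2.2 then 1 else 0) * T x'' y'' z'')) := by
    intro j
    rw [Finset.sum_eq_single x'' (fun x _ hx => by simp [hx]) (by simp),
      Finset.sum_eq_single y'' (fun y _ hy => by simp [hy]) (by simp),
      Finset.sum_eq_single z'' (fun z _ hz => by simp [hz]) (by simp)]
    simp only [true_and, partSubtensor]
    by_cases h1 : pX x'' ∈ A j.1 <;> by_cases h2 : pY y'' ∈ B j.2.1 <;>
      by_cases h3 : pZ z'' ∈ C j.2.2 <;> simp [h1, h2, h3]
  simp_rw [inner]
  -- sum the cell indicators over `Bool × Bool × Bool`: the product of the three two-cell sums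
  simp only [Fintype.sum_prod_type]
  have hfac := sum_sum_sum_mul_factor (fun a : Bool => if pX x'' ∈ A a then (1 : K) else 0)
    (fun b : Bool => if pY y'' ∈ B b then (1 : K) else 0)
    (fun c : Bool => if pZ z'' ∈ C c then (1 : K) else 0) (T x'' y'' z'')
  rw [hfac]
  simp only [Fintype.sum_bool, boole_true_add_boole_false A hA, boole_true_add_boole_false B hB,
    boole_true_add_boole_false C hC]
  simp only [partSubtensor]
  by_cases h1 : pX x'' ∈ A false ∪ A true <;> by_cases h2 : pY y'' ∈ B false ∪ B true <;>
    by_cases h3 : pZ z'' ∈ C false ∪ C true <;> simp [h1, h2, h3]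

end Glue

end Literature.Computability.AlgebraicComplexity
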